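import Summits.QuantumFields.YangMills.Theorems.UnitScaleTiltProp7QSymCovDefectT3
import Summits.QuantumFields.YangMills.Theorems.UnitScaleTiltProp7TwistDefectOfRegPr
import HarnessLib

/-!
# Route `UnitScaleTilt`, crux K1 child «MinimiserStabilityRegPr» (stmt-QuantumFields-19200), stub `stub_existenceMinimalOrbit` (EX), route (α), node (AVG-SYM),
# row (46)∕M12, brick (T2) — **(46-δ-cov) AT A PRINTED-REGULAR BACKGROUND IN THE GAUGES OF (T1)**: `RegPr F n K ε₀ U₀`, `10⁷L³ε₀ ≤ 1`, the block-centre axial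
# gauges `σ_c := axialT U₀ (toFine (K−n) (e c)₋)` of ★w4-19200 g2's `Prop7TwistDefectOfRegPr` (p603810; `flat_centreAxial_of_regPr`: `s = 3`) ⇒
# `‖QSym F n K h U₀ Y c − T_c⁻¹·(QSym F n K h 1 (Ad_{σ_c} Y) c)·T_c‖ ≤ 5.76·10¹¹·L³·ε₀·L^{K−n}·‖Y‖` — the (T2) row of ★★OWNER RULING M12 (2026-08-28T03:46:59Z)
# in the SAME gauges as the (T1) rows (γ)∕(δ), so the M12 knit (`exists_rightInv_QSym_of_approx`, ★w2-19200 g2 p603598) composes them by name.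

Cell `ym3-torus`, width seat `ym-ust-20520-w4` (gen 2).  YM₃ on T³ is a ladder rung (R3), NOT the Clay problem; nothing here is a claim about the stub, the crux, d = 4
or the mass gap.  `--supports stmt-QuantumFields-19200 --as helper`; count-neutral; def-free; `exact` over `norm_QSym_sub_conj_QSym_one_le` (this seat) and
`flat_centreAxial_of_regPr` (★w4-19200 g2).  DISPLAYED: only (T1)'s two-cell no-wrap margin `hN4 : 4·L^{K−n} ≤ (F.P K).sitesPerDir 0`.

References: T. Bałaban, CMP **102** (1985) 277–309 [Balaban1985Variational] ((44)–(46) p.285); CMP **98** (1985) 17–51 [Balaban1985Averaging] ((8)–(12) p.19,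
Prop. 4 (134)–(135) p.38); CMP **109** (1987) 249–301 [Balaban1987RG1] ((0.4) p.253).
-/

noncomputable section

open scoped BigOperators Matrix.Norms.L2Operator
open NormedSpace Metric Set

namespace Summit.QuantumFields.YangMills.Theorems.Prop7SymAvgRelativeBound

open Literature.MathematicalPhysics.QuantumFieldTheory.Balaban1983to89
open Literature.MathematicalPhysics.QuantumFieldTheory.Balaban1983to89.T3ContinuumYM3Torus
open T3PrintedRegularMinimiser (RegPr)
open T3SectALandauChart (pos_of_regPr)
open T4Continuum
open B5Eq118OneStroke (iterBlockOf)
open B10Eq27TorusAxialLog (axialT gaugeActT gaugeActT_eq_gaugeAct)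
open B10Eq38TorusDomains (toFine)
open Summit.QuantumFields.YangMills.Theorems.Prop7SymAvgGL (QSym)
open Summit.QuantumFields.YangMills.Theorems.Prop7TwistDefectOfRegPr (flat_centreAxial_of_regPr)

variable (F : T3Family) (n K : ℕ) (h : n ≤ K)
variable {F n K}

/-- ★★★ **(46-δ-cov) AT `RegPr`, IN THE (T1) GAUGES.**  For a member `(F, n, K)`, `n ≤ K`, `RegPr F n K ε₀ U₀`, `10⁷L³ε₀ ≤ 1`, the no-wrap margin
`4·L^{K−n} ≤ sitesPerDir 0`, every `Y` and coarse bond `c`, with `σ_c := axialT U₀ (toFine (K−n) (e c)₋)`, `T_c := σ_c^{(K−n)}((e c)₋)`, `e c := bondShift … c`: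
`‖QSym F n K h U₀ Y c − T_c⁻¹·(QSym F n K h 1 (Ad_{σ_c} Y) c)·T_c‖ ≤ 5.76·10¹¹·L³·ε₀·L^{K−n}·‖Y‖` (k-free coefficient of the un-rescaled gain `L^{K−n}`).
[cite: Balaban1985Variational, (44)-(46) p.285; Balaban1985Averaging, (8)-(12) p.19, Prop. 4 (134)-(135) p.38; Balaban1987RG1, (0.4) p.253] -/
theorem norm_QSym_sub_conj_QSym_one_le_of_regPr {ε₀ : ℝ} (hε : 10 ^ 7 * (F.L : ℝ) ^ 3 * ε₀ ≤ 1)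
    (U₀ : GaugeField (F.P K) 0 (Matrix.specialUnitaryGroup (Fin 2) ℂ)) (hreg : RegPr F n K ε₀ U₀)
    (hN4 : 4 * (F.P K).L ^ (K - n) ≤ (F.P K).sitesPerDir 0)
    (Y : PBond (F.P K) 0 → Matrix (Fin 2) (Fin 2) ℂ) (c : PBond (F.P n) 0) :
    ‖QSym F n K h U₀ Y c -
        (((transfUp (axialT U₀ (toFine (K - n)
              (T3LevelShift.bondShift (F.sitesPerDir_eq (m := F.m) (K := n) (j := 0) (m' := F.m) (K' := K) (j' := K - n) (by omega)) c).src)) (K - n)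
            (T3LevelShift.bondShift (F.sitesPerDir_eq (m := F.m) (K := n) (j := 0) (m' := F.m) (K' := K) (j' := K - n) (by omega)) c).src)⁻¹ :
              Matrix.specialUnitaryGroup (Fin 2) ℂ) : Matrix (Fin 2) (Fin 2) ℂ) *
          QSym F n K h 1 (fun b =>
            ((axialT U₀ (toFine (K - n)
                (T3LevelShift.bondShift (F.sitesPerDir_eq (m := F.m) (K := n) (j := 0) (m' := F.m) (K' := K) (j' := K - n) (by omega)) c).src) b.src :
                  Matrix.specialUnitaryGroup (Fin 2) ℂ) : Matrix (Fin 2) (Fin 2) ℂ) * Y b *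
            (((axialT U₀ (toFine (K - n)
                (T3LevelShift.bondShift (F.sitesPerDir_eq (m := F.m) (K := n) (j := 0) (m' := F.m) (K' := K) (j' := K - n) (by omega)) c).src) b.src)⁻¹ :
                  Matrix.specialUnitaryGroup (Fin 2) ℂ) : Matrix (Fin 2) (Fin 2) ℂ)) c *
          ((transfUp (axialT U₀ (toFine (K - n)
              (T3LevelShift.bondShift (F.sitesPerDir_eq (m := F.m) (K := n) (j := 0) (m' := F.m) (K' := K) (j' := K - n) (by omega)) c).src)) (K - n)
            (T3LevelShift.bondShift (F.sitesPerDir_eq (m := F.m) (K := n) (j := 0) (m' := F.m) (K' := K) (j' := K - n) (by omega)) c).src :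
              Matrix.specialUnitaryGroup (Fin 2) ℂ) : Matrix (Fin 2) (Fin 2) ℂ)‖ ≤
      576000 * 10 ^ 6 * (F.L : ℝ) ^ 3 * ε₀ * (F.L : ℝ) ^ (K - n) * ‖Y‖ := by
  have hε₀ : 0 < ε₀ := pos_of_regPr F hreg
  have hmain := norm_QSym_sub_conj_QSym_one_le h hε₀ hε U₀
    (fun c' => axialT U₀ (toFine (K - n)
      (T3LevelShift.bondShift (F.sitesPerDir_eq (m := F.m) (K := n) (j := 0) (m' := F.m) (K' := K) (j' := K - n) (by omega)) c').src))
    (s := 3) (by norm_num) le_rfl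
    (fun c' b hs ht => by
      rw [gaugeActT_eq_gaugeAct]
      exact flat_centreAxial_of_regPr F hreg hN4 _ b hs ht)
    Y c
  refine hmain.trans (le_of_eq ?_)
  ring

end Summit.QuantumFields.YangMills.Theorems.Prop7SymAvgRelativeBound

end
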